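import Summits.NavierStokesRegularity.TurbBounds.Certs.N1prime.EvalRule
import Summits.NavierStokesRegularity.TurbBounds.Certs.N1prime.B035
import Literature.Computation.Certificates.Blocks
import HarnessLib

/-!
# Row N1prime evaluator — BLOCK IDENTITY 35/59: `B035.A = den • Mel ε u v` (block 35, tan-right on [8741/512, 8933/512])
(cell `pub-turb` / `turb-bounds`, v2 item RB-N1′-in-Lean per HOME/pub-turb-cert/RB-LEAN-V2-DESIGN.md §1; producer of THIS FILE pub-turb-cert = prover-pub-turb-cert-g7-0 (t12_evaluator_rb.py, the P > 0 extension of pub-turb-sos's t12_evaluator.py); row and source container by pub-turb-cert: `HOME/pub-turb-cert/certs/N1prime-canary-ra1e4-allk/rbcert.json`, rbcert/0, sha256 `5daad8d71401bf8a…`; CERTIFIED.md row RB-N1′: Ra = 10000, ALL horizontal periods / lattices, `Nu ≤ 871753553815459157/273640575184404480` (outward decimal 3.1857613).)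

HONEST FRAMING: rigorous bounds for the stated PDE and boundary conditions; no claim about physical turbulence beyond the bound.
FILE LAYOUT of the row-N1prime evaluator (one namespace `Summit.NavierStokesRegularity.TurbBounds.Certs.N1prime.Evaluator` reopened across the files, every file ≤ 400 lines; the layout of the tree's `Certs/N0` (lemma R-I′ rows) and `Certs/P2R4` (per-interval COVER files) evaluators): `EvalData1…7.lean` (§1–2: constants and the 14 piece matrices — DATA) → `EvalRule.lean` (§3: the rule `Mel`, its pencil forms, the real pencil `MelR` and the block-to-pencil transfer) → `EvalGramB.lean` + `EvalGrams.lean` (§4: `Bcoef ⪰ 0` by a streaming integer Gram certificate, `Acoef ⪰ 0` diagonal, `TT ⪰ 0` Gram) → `EvalBlock01…59.lean` (§5: one file per block, the evaluator identity `eval_j : B0jj.A = den_j • Mel ε_j u_j v_j` against the landed block module, via the LIST identity `B0jj.A_rows = EvalRows.lincomb (psOf …)` — `TurbBounds/EvalRows.lean`) → `Cover01…Cover30.lean` (§6: per cover interval, the interval theorem `interval_i`) → `Evaluator.lean` (§8: **`certificate`**; `cutoff` is in EvalData1 — the full statement of what is and is NOT kernel-checked is in THAT file's header); generic interval lemmas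 in `TurbBounds/IntervalLemma.lean` + `IntervalLemmaR.lean` (in the tree).
-/

set_option linter.style.longLine false
set_option linter.style.setOption false
set_option linter.unusedSimpArgs false
set_option maxRecDepth 100000

namespace Summit.NavierStokesRegularity.TurbBounds.Certs.N1prime.Evaluator

open Literature.Computation.Certificates Matrix

/-! ## 5. Evaluator identity of block 35 -/

/-- block 35 (tan-right on [8741/512, 8933/512]): datum `u = 512/8933` (= KINV2). -/
def u35 : ℚ := ((512 : ℚ) / 8933)
/-- block 35: datum `v` (= K2, lower bound for `K` on the block's range; `0` for the bottom block). -/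
def v35 : ℚ := ((8933 : ℚ) / 512)
/-- block 35: Young weight `ε` (rbsdp SPEC 3.6 rule at this block's `u`, rounded, as stored in the container). -/
def ε35 : ℚ := ((113371 : ℚ) / 1000000)
/-- block 35: the positive integer denominator cleared by the certificate container (`Cn = den·M`). -/
def den35 : ℚ := (1904500603955657851878504220843082420596331781032732157542400000000 : ℚ)
/-- `0 < den`. -/
theorem den35_pos : 0 < den35 := by norm_num [den35]
set_option maxHeartbeats 0 in
/-- evaluator identity at the LIST level: the block's rows ARE the assembled rows of `den • Mel ε35 u35 v35` (kernel `decide`, one pass per piece — `TurbBounds/EvalRows.lean`). -/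
theorem eval35_rows : B035.A_rows = EvalRows.lincomb 62 (psOf den35 ε35 u35 v35) := by
  decide +kernel
/-- **Evaluator identity for block 35**: the certified block IS the rule at its data. -/
theorem eval35 : B035.A = den35 • Mel ε35 u35 v35 := eval_of_rows eval35_rows

end Summit.NavierStokesRegularity.TurbBounds.Certs.N1prime.Evaluator
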